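import Summits.ResolutionOfSingularities.ResolutionOfSingularities.Theorems.HomologicalConductorNoZenoRPowersContracted
import Summits.ResolutionOfSingularities.ResolutionOfSingularities.Theorems.HomologicalConductorNoZenoRLipman41Of81
import Literature.AlgebraicGeometry.Resolution.Lipman1969QuadraticTransformNormal
import Literature.AlgebraicGeometry.Resolution.AffineBlowupRegular
import Literature.AlgebraicGeometry.Resolution.RegularLocalRingsProofs
import Mathlib.RingTheory.DedekindDomain.Basic
import HarnessLib

/-!
# Crux `NoZenoR` (stmt-ResolutionOfSingularities-19943) — `Lipman1969_8_1 ⟸ Lipman1969_7_2`: the quadratic transform of a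
# rational surface singularity is normal, GIVEN Theorem (7.2) (contracted products) on one desingularization

Route `ResolutionOfSingularities/HomologicalConductor` (cell decomp-res, hand leafhand-res-homologicalconduct-22 g0).
OURS: AI-written bookkeeping, weaker than expert review; nothing here is a statement of the manuscript under review
(Hironaka 2017).  SUPPORT level, counted 0.  Def-free.

* `isRegular_affineBlowup_maximalIdeal` / `isIntegrallyClosed_stalk_affineBlowup_of_isRegularLocalRing` — the REGULAR
  case of Prop. (8.1), fact-free: the blowing up of `Spec S` at the closed point of a regular local ring `S` is a regular
  scheme (a regular system of parameters is a regular sequence with quotient a field: tree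
  `affineBlowup.isRegular_of_isWeaklyRegular`, Liu Thm. 8.1.19 (a); Serre's localization theorem
  `isRegularLocalRing_localization_atPrime` for `IsRegularRing S`), hence normal (Matsumura 19.4).
* `Lipman1969_8_1_of_7_2` — **`Lipman1969_8_1 ⟸ Lipman1969_7_2`** (universe `0`): for non-regular `S` take a
  desingularization `π` (from `HasRationalSingularity S`); by the named fact the powers `𝔪ⁿ` are contracted for `π`, hence
  complete (`…PowersContracted`, via Prop. (3.1) stalkwise), hence `Bl_𝔪(Spec S)` is normal by Lemma (5.2)
  (`affineBlowup.isIntegrallyClosed_stalk_of_forall_pow`).  CONDITIONAL on the named fact `Lipman1969_7_2`.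
* `Lipman1969_4_1_of_7_2` — hence the W3 print `Lipman1969_4_1` (minimal desingularization) from Theorem (7.2) alone
  (with hand 21's `Lipman1969_4_1_of_8_1`).

Net effect: the crux chain's print `Lipman1969_4_1` ⟸ `Lipman1969_8_1` ⟸ EITHER `Lipman1969_7_1` (products of complete
ideals; `…Lipman81Of71`) OR `Lipman1969_7_2` (products of contracted ideals on one desingularization; this file) — the
latter being the purely cohomological statement (Lemma (7.3): `Γ(𝔪𝒪_X) ⊗ Γ(𝔪ⁿ𝒪_X) ↠ Γ(𝔪ⁿ⁺¹𝒪_X)` from `H¹ = 0`).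

No crux, kill test or summit statement is proved here; resolution in positive characteristic is NOT proved.

References: J. Lipman, *Rational singularities, with applications to algebraic surfaces and unique factorization*, Publ.
Math. IHÉS 36 (1969): Theorem (7.2) (p. 209), Proposition (8.1) (p. 212), Lemma (5.2) (p. 206), Theorem (4.1) (p. 204)
[`Lipman1969`]; Q. Liu, *Algebraic Geometry and Arithmetic Curves* (2002), Thm. 8.1.19 (a) [`Liu2002`]; H. Matsumura,
*Commutative Ring Theory* (1986), Thms. 19.3, 19.4 [`Matsumura1987`].
-/

noncomputable section

-- single-problem summit: the doubled namespace component `ResolutionOfSingularities` is forced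
set_option linter.dupNamespace false

open CategoryTheory AlgebraicGeometry TopologicalSpace IsLocalRing
open Literature.AlgebraicGeometry.Resolution

namespace Summit.ResolutionOfSingularities.ResolutionOfSingularities.Theorems.NoZeno.QuadraticTransform

universe u

/-- **The blowing up of the closed point of a regular local ring is a regular scheme**: a regular system of parameters
is a regular sequence generating `𝔪` with quotient the residue field, so Liu Thm. 8.1.19 (a) in its affine,
globally-generated form (`affineBlowup.isRegular_of_isWeaklyRegular`) applies; `IsRegularRing S` by Serre's localization
theorem. [cite: Liu2002, Thm. 8.1.19 (a); Matsumura1987, Thm. 19.3] -/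
theorem isRegular_affineBlowup_maximalIdeal {S : Type u} [CommRing S] [IsRegularLocalRing S] :
    Scheme.IsRegular (affineBlowup (maximalIdeal S)) := by
  classical
  haveI : IsRegularRing S :=
    { isRegularLocalRing_localization := fun p _ => isRegularLocalRing_localization_atPrime S p }
  obtain ⟨rs, hreg, hspan, -⟩ := exists_isRegular_ofList_eq_maximalIdeal S
  set x : Fin rs.length → S := rs.get with hx
  have hrange : Ideal.span (Set.range x) = maximalIdeal S := by
    rw [← hspan, hx, Set.range_list_get]
  have hofFn : List.ofFn x = rs := by rw [hx, List.ofFn_get]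
  haveI : IsRegularRing (S ⧸ Ideal.span (Set.range x)) := by
    rw [hrange]
    have h : IsRegularRing (ResidueField S) := inferInstance
    exact h
  have h := affineBlowup.isRegular_of_isWeaklyRegular x (by rw [hofFn]; exact hreg.toIsWeaklyRegular)
  rwa [hrange] at h

/-- **Prop. (8.1), regular case (fact-free)**: every local ring of the blowing up of `Spec S` at the closed point of a
regular local ring `S` is an integrally closed domain (regular local rings are normal, Matsumura 19.4).
[cite: Lipman1969, Proposition (8.1) (p. 212); Matsumura1987, Thm. 19.4] -/
theorem isIntegrallyClosed_stalk_affineBlowup_of_isRegularLocalRing {S : Type u} [CommRing S] [IsRegularLocalRing S]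
    (y : affineBlowup (maximalIdeal S)) : IsIntegrallyClosed ((affineBlowup (maximalIdeal S)).presheaf.stalk y) := by
  haveI := isRegular_affineBlowup_maximalIdeal (S := S) y
  exact isIntegrallyClosed_of_isRegularLocalRing _

/-- **`Lipman1969_8_1 ⟸ Lipman1969_7_2`** (universe `0`): the quadratic transform `Bl_𝔪(Spec S)` of a two-dimensional
normal local domain with a rational singularity is normal, GIVEN Theorem (7.2) for one desingularization of `Spec S`.
Regular `S`: fact-free (`isIntegrallyClosed_stalk_affineBlowup_of_isRegularLocalRing`).  Non-regular `S`: a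
desingularization `π` exists (`HasRationalSingularity`); by (7.2) the powers `𝔪ⁿ` are contracted for `π`, hence complete
(`forall_mem_pow_maximalIdeal_of_integralDependence_of_mul`: `\overline{𝔪ⁿ} ⊆ Γ(X, 𝔪ⁿ𝒪_X) ∩ S` by Prop. (3.1)), hence
`Bl_𝔪(Spec S)` is normal by Lemma (5.2).  CONDITIONAL on the named fact `Lipman1969_7_2`.
[cite: Lipman1969, Proposition (8.1) (p. 212); Theorem (7.2) (p. 209); Lemma (5.2) (p. 206)] -/
theorem Lipman1969_8_1_of_7_2 (h72 : Lipman1969_7_2.{0}) : Lipman1969_8_1.{0} := by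
  intro S _ _ _ _ _ hdim hrat y
  by_cases hreg : IsRegularLocalRing S
  · exact isIntegrallyClosed_stalk_affineBlowup_of_isRegularLocalRing y
  · have hrat' := hrat
    obtain ⟨X, π, hπ, -⟩ := hrat'
    exact isIntegrallyClosed_stalk_affineBlowup_of_mul π hdim hrat hreg hπ
      (fun I J hI hJ r hr => h72 S hdim hrat X π hπ I J hI hJ r hr) y

/-- **`Lipman1969_4_1 ⟸ Lipman1969_7_2`** (universe `0`): the minimal desingularization of a normal surface with finitely
many rational singular points exists, GIVEN Theorem (7.2) — through (8.1) (`Lipman1969_8_1_of_7_2`) and hand 21's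
assembly of Lipman's proof of Theorem (4.1) (`Lipman1969_4_1_of_8_1`).  CONDITIONAL on `Lipman1969_7_2`.
[cite: Lipman1969, Theorem (4.1) (p. 204), Theorem (7.2) (p. 209), Proposition (8.1) (p. 212)] -/
theorem Lipman1969_4_1_of_7_2 (h72 : Lipman1969_7_2.{0}) : Lipman1969_4_1.{0} :=
  Lipman1969_4_1_of_8_1 (Lipman1969_8_1_of_7_2 h72)

/-- **The consumed local form from (7.2)**: a two-dimensional normal Noetherian local domain with a rational singularity
has a minimal desingularization of `Spec S` which is a blowing up along a centre cosupported at the closed point, GIVEN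
Theorem (7.2). [cite: Lipman1969, Theorem (4.1) (p. 204); Theorem (7.2) (p. 209)] -/
theorem exists_isMinimalResolution_isBlowup_of_7_2 (h72 : Lipman1969_7_2.{0}) {S : Type} [CommRing S]
    [IsNoetherianRing S] [IsLocalRing S] [IsDomain S] [IsIntegrallyClosed S] (hdim : ringKrullDim S = 2)
    (hrat : HasRationalSingularity S) :
    ∃ (X₀ : Scheme.{0}) (f : X₀ ⟶ Spec (.of S)) (J : (Spec (.of S)).IdealSheafData),
      IsMinimalResolution f ∧ IsBlowup f J ∧ (J.support : Set (Spec (.of S))) ⊆ {closedPoint S} :=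
  exists_isMinimalResolution_isBlowup_of_8_1 (Lipman1969_8_1_of_7_2 h72) hdim hrat

end Summit.ResolutionOfSingularities.ResolutionOfSingularities.Theorems.NoZeno.QuadraticTransform

end
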